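import Mathlib
import Summits.Ventures.HodgeRepro.Tier4.Line1.GeneratedSubspace
import Summits.Ventures.HodgeRepro.Tier4.Line1.RelClosed
import Summits.Ventures.HodgeRepro.Tier4.Line1.InnerCalculus
import Summits.Ventures.HodgeRepro.Tier4.Line1.KernelAdjoint
import Summits.Ventures.HodgeRepro.Tier4.Line1.KernelNondegenerate

/-!
# Tier4/Line1/IsotypicBernsteinCore — THE KILL LEMMA and THE WELL-DEFINEDNESS LEMMA of the Bernstein argument: a
vector of an irreducible constituent all of whose `R(h)`-translates are killed by `R(e)` is zero (when `R(e)` fixes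
some non-zero vector of the constituent), and an `H`-linear map of fixed blocks `θ : W i → W j` respects the
relations among the generators `R(f) w` of the algebraic cores

Blind re-derivation cell `pub-hodge-repro`, Tier 4 (README §9–§10), seat t4-L1-p2 (gen 4), LINE L1; the first
module of the cut (C2-BERNSTEIN) (S14153, plan-1 YES S14157; the two halves announced as `IsotypicKill` +
`IsotypicBernstein` are filed as THIS module + `IsotypicBernstein` + `IsotypicBernsteinIso`).  Target tree path
`lean/Summits/Ventures/HodgeRepro/Tier4/Line1/IsotypicBernsteinCore.lean`.  Imports this seat's `GeneratedSubspace`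
(`generated`, `isInvariantSubspace_generated`, `generated_subset`, `R_mem_generated`, `R_R_eq_R_conv`, `R_add'`,
`R_smul'`, `R_zero'`), t4-L1-p4's `RelClosed` (`toLp_R_eq`, `norm_toLp_sub`, `continuous_R_of_invariant`,
`R_invariant`), `InnerCalculus` (`eq_of_ae_eq_DG`, `countable_Gk`), `KernelAdjoint` (`kernelOp_congr_ae`,
`exists_kernelCLM` through it) and t4-L1-p1's `KernelNondegenerate` (`kernelOp_nondegenerate`).  0 print.

WHAT IS PROVED.  (1) `eq_zero_of_R_R_eq_zero` (THE KILL LEMMA): `V` an invariant IRREDUCIBLE subspace (the tree's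
`IsIrreducible`: every invariant subspace of `V` is zero or `L²(DG)`-dense in `V`), `e` a test function, `v ∈ V`
with `R(e) (R(h) v) = 0` for EVERY test function `h`, and some `w ∈ V`, `w ≠ 0`, with `R(e) w = w`.  Then `v = 0`.
PROOF: `V' := generated (span {v}) = span {R(h) v}` is an invariant subspace of `V` (p687702) on which `R(e)`
vanishes; (zero branch) every `R(h) v` vanishes, so the class of `v` in `L²(DG)` is killed by every kernel operator
and is `0` by t4-L1-p1's non-degeneracy (`kernelOp_nondegenerate`, `kernelOp_eq_R`), hence `v = 0`
(`eq_of_ae_eq_DG`); (dense branch) the class of `w` is an `L²(DG)`-limit of classes of `u_n ∈ V'`, the bounded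
operator `T_e` of `R(e)` on `L²(DG)` (`exists_kernelCLM`) fixes the class of `w` (`toLp_R_eq`) and kills the
classes of the `u_n`, so `‖w‖₂ ≤ ‖T_e‖ ε` for every `ε`, `w = 0` a.e. on `DG`, `w = 0` — against `w ≠ 0`.
(2) `sum_R_map_eq_zero` (WELL-DEFINEDNESS): in p5's block vocabulary (`Vb` the fixed space of `R(e)` on the
continuous invariant functions, `hVb`; the `H`-action `r • ψ = R (tst r) ψ`, `hact`) with the DISPLAYED clause
`hfull` («`H ⊇ e ⋆ C_c(G) ⋆ e`»: for every test function `f` some `r : H` acts on `Vb` as `R(e) R(f)` — the SAME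
clause as BlockSimple p688105, with `e := R(e)`; applied to `f := h ⋆ f_k` through the composition law), for an
`H`-linear map `θ : W i →ₗ[H] W j` of fixed blocks of invariant constituents with `V j` IRREDUCIBLE: if a finite
combination `∑ R(f_k) w_k` of generators vanishes (`f_k` test functions, `w_k ∈ W i`), so does `∑ R(f_k) (θ w_k)`.
PROOF: `v := ∑ R(f_k) (θ w_k) ∈ V j`; for every test function `h`, `R(e) R(h) v = ∑ R(tst r_k) (θ w_k)` with
`r_k` from `hfull` `= ∑ ↑(θ (r_k • w_k)) = ↑(θ (∑ r_k • w_k))` (`hact`, `θ` `H`-linear), and `↑(∑ r_k • w_k) =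
R(e) R(h) (∑ R(f_k) w_k) = 0`; so `R(e)` kills every `R(h) v`, and (1) with the fixed non-zero vector `θ w_k` for
some `k` (or `v = 0` outright when all `θ w_k = 0`) gives `v = 0`.  Helpers: `eq_zero_of_toLp_eq_zero`,
`eq_zero_of_forall_R_eq_zero`, `R_smul_left` (`R(c • f) = c • R(f)`), `IsTest.smul`, `R_finset_sum`,
`IsInvariantSubspace.sum_mem`.

Nothing here says anything about the status of the Hodge conjecture for CM abelian varieties, which is NOT proved
(HC_CM is NOT proved by anyone in this repository).
-/

set_option autoImplicit false

noncomputable section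

namespace Summit.Ventures.HodgeRepro.Tier4.Line1

open MeasureTheory Topology

namespace RTF

namespace Setting

variable {G : Type} [Group G] [TopologicalSpace G] [IsTopologicalGroup G] [MeasurableSpace G] [BorelSpace G]
  (S : Setting G)

section Kill

/-- the class of a continuous invariant function is `0` in `L²(DG)` only when the function vanishes. -/
theorem eq_zero_of_toLp_eq_zero [Countable S.Gk] {v : G → ℂ} (hvi : S.Invariant v) (hvc : Continuous v)
    (h0 : (S.memLp_two_DG hvc).toLp v = 0) : v = 0 := by
  have hae : v =ᵐ[S.μ.restrict S.DG] 0 := by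
    have h1 := MemLp.coeFn_toLp (S.memLp_two_DG hvc)
    rw [h0] at h1
    exact h1.symm.trans (Lp.coeFn_zero ℂ 2 (S.μ.restrict S.DG))
  exact S.eq_of_ae_eq_DG hvi hvc (fun _ _ => rfl) continuous_const hae

/-- **a continuous invariant function killed by every `R(f)` is zero** (t4-L1-p1's `kernelOp_nondegenerate` read
through `kernelOp_eq_R`). -/
theorem eq_zero_of_forall_R_eq_zero [LocallyCompactSpace G] [SecondCountableTopology G] {v : G → ℂ}
    (hvi : S.Invariant v) (hvc : Continuous v) (hR : ∀ f, IsTest f → S.R f v = 0) : v = 0 := by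
  haveI : Countable S.Gk := S.countable_Gk
  by_contra hv0
  have htoLp : (S.memLp_two_DG hvc).toLp v ≠ 0 := fun h0 => hv0 (S.eq_zero_of_toLp_eq_zero hvi hvc h0)
  obtain ⟨f, hf, hne⟩ := S.kernelOp_nondegenerate _ htoLp
  apply hne
  have hk : S.kernelOp f ⇑((S.memLp_two_DG hvc).toLp v) = S.R f v := by
    rw [S.kernelOp_congr_ae f (MemLp.coeFn_toLp (S.memLp_two_DG hvc))]
    funext x
    exact S.kernelOp_eq_R hf hvi hvc x
  rw [hk, hR f hf]

/-- **the kill lemma**: `V` invariant and irreducible, `e` a test function, `v ∈ V` with `R(e) (R(h) v) = 0` for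
every test function `h`, and a non-zero `w ∈ V` fixed by `R(e)`.  Then `v = 0`. -/
theorem eq_zero_of_R_R_eq_zero [SecondCountableTopology G] [T2Space G] [MeasurableMul G] [SFinite S.μ]
    [LocallyCompactSpace G] {V : Set (G → ℂ)} (hV : S.IsInvariantSubspace V) (hirr : S.IsIrreducible V)
    {e : G → ℂ} (he : IsTest e) {v : G → ℂ} (hv : v ∈ V) (hkill : ∀ h, IsTest h → S.R e (S.R h v) = 0)
    {w : G → ℂ} (hw : w ∈ V) (hw0 : w ≠ 0) (hwe : S.R e w = w) : v = 0 := by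
  haveI : Countable S.Gk := S.countable_Gk
  have hvi := hV.inv v hv
  have hvc := hV.cont v hv
  -- the invariant subspace generated by `v`
  set N : Submodule ℂ (G → ℂ) := Submodule.span ℂ {v} with hN
  have hNV : (N : Set (G → ℂ)) ⊆ V := by
    intro u hu
    rw [SetLike.mem_coe, hN, Submodule.mem_span_singleton] at hu
    obtain ⟨c, rfl⟩ := hu
    exact hV.smul v hv c
  have hV' := S.isInvariantSubspace_generated hV hNV
  have hsub := S.generated_subset hV hNV
  -- `R(e)` kills it
  have hkill' : ∀ u ∈ S.generated N, S.R e u = 0 := by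
    intro u hu
    refine Submodule.span_induction (p := fun u _ => S.R e u = 0) ?_ ?_ ?_ ?_ hu
    · rintro u ⟨h, hh, n, hn, rfl⟩
      rw [hN, Submodule.mem_span_singleton] at hn
      obtain ⟨c, rfl⟩ := hn
      rw [S.R_smul' h v c, S.R_smul' e _ c, hkill h hh, smul_zero]
    · rw [S.R_zero']
    · intro x y hx hy hx' hy'
      rw [S.R_add' he (hV.cont x (hsub hx)) (hV.cont y (hsub hy)), hx', hy', add_zero]
    · intro c x _ hx'
      rw [S.R_smul', hx', smul_zero]
  rcases hirr _ hV' hsub with hzero | hdense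
  · -- zero branch: every `R(h) v` vanishes, so `v = 0`
    refine S.eq_zero_of_forall_R_eq_zero hvi hvc fun f hf => ?_
    exact funext fun x => hzero _ (S.R_mem_generated hf (Submodule.mem_span_singleton_self v)) x
  · -- dense branch: the fixed vector `w` is a limit of killed vectors, so `w = 0`
    exfalso
    apply hw0
    have hwi := hV.inv w hw
    have hwc := hV.cont w hw
    obtain ⟨T, hT⟩ := S.exists_kernelCLM he
    -- `T` fixes the class of `w`
    have hTw : T ((S.memLp_two_DG hwc).toLp w) = (S.memLp_two_DG hwc).toLp w := by
      have hRc : Continuous (S.R e w) := by rw [hwe]; exact hwc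
      rw [S.toLp_R_eq he T hT hwi hwc hRc]
      exact MemLp.toLp_congr _ _ (by rw [hwe])
    -- `T` kills the classes of the generated subspace
    have hTu : ∀ u ∈ S.generated N, ∀ huc : Continuous u, T ((S.memLp_two_DG huc).toLp u) = 0 := by
      intro u hu huc
      have hui := hV.inv u (hsub hu)
      have hRc : Continuous (S.R e u) := by rw [hkill' u hu]; exact continuous_const
      rw [S.toLp_R_eq he T hT hui huc hRc]
      apply Lp.ext
      filter_upwards [MemLp.coeFn_toLp (S.memLp_two_DG hRc), Lp.coeFn_zero ℂ 2 (S.μ.restrict S.DG)] with x h1 h2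
      rw [h1, h2, hkill' u hu]
    -- `‖w‖₂ ≤ ‖T‖ ε` for every `ε`
    have hbound : ∀ ε : ℝ, 0 < ε → ‖(S.memLp_two_DG hwc).toLp w‖ ≤ ‖T‖ * ε := by
      intro ε hε
      obtain ⟨u, hu, hεu⟩ := hdense w hw ε hε
      have huc := hV.cont u (hsub hu)
      calc ‖(S.memLp_two_DG hwc).toLp w‖
          = ‖T ((S.memLp_two_DG hwc).toLp w)‖ := by rw [hTw]
        _ = ‖T ((S.memLp_two_DG hwc).toLp w - (S.memLp_two_DG huc).toLp u)‖ := by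
            rw [map_sub, hTu u hu huc, sub_zero]
        _ ≤ ‖T‖ * ‖(S.memLp_two_DG hwc).toLp w - (S.memLp_two_DG huc).toLp u‖ := T.le_opNorm _
        _ ≤ ‖T‖ * ε := by
            refine mul_le_mul_of_nonneg_left ?_ (norm_nonneg _)
            rw [S.norm_toLp_sub hwc huc]
            exact ENNReal.toReal_le_of_le_ofReal hε.le hεu.le
    -- hence the class of `w` is `0`
    have h0 : (S.memLp_two_DG hwc).toLp w = 0 := by
      by_contra hne
      have hpos : 0 < ‖(S.memLp_two_DG hwc).toLp w‖ := norm_pos_iff.2 hne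
      have hε : 0 < ‖(S.memLp_two_DG hwc).toLp w‖ / (2 * (‖T‖ + 1)) := by positivity
      have h := hbound _ hε
      have hlt : ‖T‖ * (‖(S.memLp_two_DG hwc).toLp w‖ / (2 * (‖T‖ + 1))) < ‖(S.memLp_two_DG hwc).toLp w‖ := by
        rw [mul_div_assoc', div_lt_iff₀ (by positivity)]
        nlinarith [norm_nonneg T]
      exact absurd (lt_of_le_of_lt h hlt) (lt_irrefl _)
    exact S.eq_zero_of_toLp_eq_zero hwi hwc h0

end Kill

section Helpers

omit [IsTopologicalGroup G] [BorelSpace G] in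
/-- `R(c • f) ψ = c • R(f) ψ`. -/
theorem R_smul_left (f ψ : G → ℂ) (c : ℂ) : S.R (c • f) ψ = c • S.R f ψ := by
  funext x
  unfold R
  rw [Pi.smul_apply, smul_eq_mul, ← integral_const_mul]
  congr 1
  funext g
  rw [Pi.smul_apply, smul_eq_mul]
  ring

omit [Group G] [IsTopologicalGroup G] [MeasurableSpace G] [BorelSpace G] in
/-- a scalar multiple of a test function is a test function. -/
theorem _root_.Summit.Ventures.HodgeRepro.Tier4.Line1.RTF.IsTest.smul {f : G → ℂ} (hf : IsTest f) (c : ℂ) :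
    IsTest (c • f) :=
  ⟨hf.cont.const_smul c, hf.compact.smul_left⟩

/-- `R(f)` of a finite sum of continuous functions. -/
theorem R_finset_sum {κ : Type} (s : Finset κ) {f : G → ℂ} (hf : IsTest f) (ψ : κ → G → ℂ)
    (hψ : ∀ k ∈ s, Continuous (ψ k)) : S.R f (∑ k ∈ s, ψ k) = ∑ k ∈ s, S.R f (ψ k) := by
  classical
  induction s using Finset.induction_on with
  | empty => simp [S.R_zero']
  | insert a s ha ih =>
    have hs : Continuous (∑ k ∈ s, ψ k) := by
      rw [show (∑ k ∈ s, ψ k) = fun x => ∑ k ∈ s, ψ k x from funext fun x => Finset.sum_apply x s ψ]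
      exact continuous_finsetSum s fun k hk => hψ k (Finset.mem_insert_of_mem hk)
    rw [Finset.sum_insert ha, Finset.sum_insert ha, S.R_add' hf (hψ a (Finset.mem_insert_self a s)) hs,
      ih fun k hk => hψ k (Finset.mem_insert_of_mem hk)]

omit [IsTopologicalGroup G] [BorelSpace G] in
/-- a finite sum of elements of a non-empty invariant subspace lies in it. -/
theorem IsInvariantSubspace.sum_mem {V : Set (G → ℂ)} (hV : S.IsInvariantSubspace V) (hne : V.Nonempty)
    {κ : Type} (s : Finset κ) (ψ : κ → G → ℂ) (hψ : ∀ k ∈ s, ψ k ∈ V) : (∑ k ∈ s, ψ k) ∈ V := by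
  classical
  induction s using Finset.induction_on with
  | empty => simpa using IsInvariantSubspace.zero_mem_of_nonempty S hV hne
  | insert a s ha ih =>
    rw [Finset.sum_insert ha]
    exact hV.add _ (hψ a (Finset.mem_insert_self a s)) _ (ih fun k hk => hψ k (Finset.mem_insert_of_mem hk))

end Helpers

section Key

variable {H : Type} [Ring H] {Vb : Submodule ℂ (G → ℂ)} [Module H Vb] {e : G → ℂ} {tst : H → G → ℂ}
  (he : IsTest e) (hVb : ∀ ψ : G → ℂ, ψ ∈ Vb ↔ S.Invariant ψ ∧ Continuous ψ ∧ S.R e ψ = ψ)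
  (hact : ∀ (r : H) (ψ : Vb), ((r • ψ : Vb) : G → ℂ) = S.R (tst r) ψ)
  (hfull : ∀ f : G → ℂ, IsTest f → ∃ r : H, ∀ ψ ∈ Vb, S.R e (S.R f ψ) = S.R (tst r) ψ)
  {Vj : Set (G → ℂ)} (hinvj : S.IsInvariantSubspace Vj) (hirrj : S.IsIrreducible Vj)
  {Wi Wj : Submodule H Vb} (hWj : ∀ ψ : Vb, ψ ∈ Wj ↔ (ψ : G → ℂ) ∈ Vj) (θ : Wi →ₗ[H] Wj)

include he hVb hact hfull hinvj hirrj hWj in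
/-- **the well-definedness lemma** (Bernstein): if `∑ R(f_k) w_k = 0` for test functions `f_k` and `w_k ∈ W i`,
then `∑ R(f_k) (θ w_k) = 0` for every `H`-linear `θ : W i → W j` into the fixed block of an irreducible
constituent `V j`. -/
theorem sum_R_map_eq_zero [SecondCountableTopology G] [T2Space G] [MeasurableMul G] [SFinite S.μ]
    [LocallyCompactSpace G] {κ : Type} (s : Finset κ) (f : κ → G → ℂ) (hf : ∀ k, IsTest (f k)) (w : κ → Wi)
    (h0 : ∑ k ∈ s, S.R (f k) ((w k : Vb) : G → ℂ) = 0) :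
    ∑ k ∈ s, S.R (f k) ((θ (w k) : Vb) : G → ℂ) = 0 := by
  classical
  -- memberships and regularity of the vectors involved
  have hθVb : ∀ k, ((θ (w k) : Vb) : G → ℂ) ∈ Vb := fun k => (θ (w k) : Vb).2
  have hθVj : ∀ k, ((θ (w k) : Vb) : G → ℂ) ∈ Vj := fun k => (hWj _).1 (θ (w k)).2
  have hθc : ∀ k, Continuous ((θ (w k) : Vb) : G → ℂ) := fun k => ((hVb _).1 (hθVb k)).2.1
  have hθi : ∀ k, S.Invariant ((θ (w k) : Vb) : G → ℂ) := fun k => ((hVb _).1 (hθVb k)).1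
  have hwVb : ∀ k, ((w k : Vb) : G → ℂ) ∈ Vb := fun k => (w k : Vb).2
  have hwc : ∀ k, Continuous ((w k : Vb) : G → ℂ) := fun k => ((hVb _).1 (hwVb k)).2.1
  have hwi : ∀ k, S.Invariant ((w k : Vb) : G → ℂ) := fun k => ((hVb _).1 (hwVb k)).1
  have hVjne : Vj.Nonempty := ⟨_, (hWj 0).1 Wj.zero_mem⟩
  have hterm_c : ∀ k, Continuous (S.R (f k) ((θ (w k) : Vb) : G → ℂ)) := fun k =>
    S.continuous_R_of_invariant (hf k) (hθi k) (hθc k)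
  have hterm_i : ∀ k, S.Invariant (S.R (f k) ((θ (w k) : Vb) : G → ℂ)) := fun k => S.R_invariant _ (hθi k)
  have hwterm_c : ∀ k, Continuous (S.R (f k) ((w k : Vb) : G → ℂ)) := fun k =>
    S.continuous_R_of_invariant (hf k) (hwi k) (hwc k)
  have hwterm_i : ∀ k, S.Invariant (S.R (f k) ((w k : Vb) : G → ℂ)) := fun k => S.R_invariant _ (hwi k)
  -- the vector `v`
  set v : G → ℂ := ∑ k ∈ s, S.R (f k) ((θ (w k) : Vb) : G → ℂ) with hv
  have hvVj : v ∈ Vj :=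
    hinvj.sum_mem S hVjne s _ fun k _ => hinvj.conv _ (hθVj k) _ (hf k)
  -- `R(e)` kills every `R(h) v`
  have hkill : ∀ h, IsTest h → S.R e (S.R h v) = 0 := by
    intro h hh
    choose r hr using fun k => hfull (S.conv h (f k)) (S.conv_isTest hh (hf k)).1
    -- the left side as a sum
    have hRv : S.R h v = ∑ k ∈ s, S.R h (S.R (f k) ((θ (w k) : Vb) : G → ℂ)) :=
      S.R_finset_sum s hh _ fun k _ => hterm_c k
    have hRRv : S.R e (S.R h v) = ∑ k ∈ s, S.R e (S.R h (S.R (f k) ((θ (w k) : Vb) : G → ℂ))) := by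
      rw [hRv]
      exact S.R_finset_sum s he _ fun k _ =>
        S.continuous_R_of_invariant hh (hterm_i k) (hterm_c k)
    -- each term is the coercion of `θ (r k • w k)`
    have hterm : ∀ k, S.R e (S.R h (S.R (f k) ((θ (w k) : Vb) : G → ℂ))) =
        (((θ (r k • w k) : Wj) : Vb) : G → ℂ) := by
      intro k
      rw [map_smul, Submodule.coe_smul, hact, ← hr k _ (hθVb k), S.R_R_eq_R_conv hh (hf k) (hθc k)]
    -- the corresponding combination of the `w k` vanishes
    have hsum_w : (∑ k ∈ s, r k • w k : Wi) = 0 := by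
      apply Subtype.ext
      apply Subtype.ext
      show ((((∑ k ∈ s, r k • w k : Wi) : Vb)) : G → ℂ) = 0
      rw [Submodule.coe_sum, Submodule.coe_sum]
      have hterm' : ∀ k ∈ s, (((r k • w k : Wi) : Vb) : G → ℂ) =
          S.R e (S.R h (S.R (f k) ((w k : Vb) : G → ℂ))) := by
        intro k _
        rw [Submodule.coe_smul, hact, ← hr k _ (hwVb k), S.R_R_eq_R_conv hh (hf k) (hwc k)]
      rw [Finset.sum_congr rfl hterm', ← S.R_finset_sum s he _ fun k _ =>
        S.continuous_R_of_invariant hh (hwterm_i k) (hwterm_c k),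
        ← S.R_finset_sum s hh _ fun k _ => hwterm_c k, h0, S.R_zero', S.R_zero']
    rw [hRRv, Finset.sum_congr rfl fun k _ => hterm k, ← Submodule.coe_sum, ← Submodule.coe_sum, ← map_sum,
      hsum_w, map_zero]
    rfl
  -- conclude with the kill lemma (or directly when all `θ (w k)` vanish)
  by_cases hall : ∀ k ∈ s, θ (w k) = 0
  · rw [hv]
    refine Finset.sum_eq_zero fun k hk => ?_
    rw [hall k hk]
    show S.R (f k) (0 : G → ℂ) = 0
    exact S.R_zero' _
  · push Not at hall
    obtain ⟨k, _, hne⟩ := hall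
    refine S.eq_zero_of_R_R_eq_zero hinvj hirrj he hvVj hkill (hθVj k) ?_ ((hVb _).1 (hθVb k)).2.2
    intro h0
    exact hne (Subtype.ext (Subtype.ext h0))

end Key

end Setting

end RTF

end Summit.Ventures.HodgeRepro.Tier4.Line1

end
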